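import Literature.NumberTheory.LFunctions.ZetaCertifiedEvaluation
import HarnessLib

/-!
# Fast tables for the certified evaluator of `ζ(s)`: quadratic-time Bernoulli numbers and an additive `log` table

Topic `Literature/NumberTheory/LFunctions`. The certified Euler–Maclaurin evaluator `zetaBox`
(`ZetaCertifiedEvaluation.lean`, soundness `mem_zetaBox`) takes a `Tables` record (scale, `N`, `ν`,
`π`, `log n` for `n ≤ N`, the Euler–Maclaurin ratios) whose standard builder `mkTables` is adequate
at the `~90`-digit precision of the Odlyzko–te Riele certificate (`N = 1000`, `ν = 150`) but not
beyond: its Bernoulli table `bernArr m` costs `Θ(m³)` big-integer multiplications (every binomial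
`C(n,k)` is recomputed as `n(n-1)⋯/k!`), and its `log` table spends `K` series terms with ratio up
to `½` on *every* `n ≤ N` (and recomputes `log 2` each time). Measured in the interpreter that
runs `native_decide`: `bernArr 1524` ≈ 980 s, the `log` table for `N = 1500` at `2^2660` ≈ 64 s, against
≈ 1.2 s for one evaluation of `ζ` — at the `~1500`-digit precision needed by the certificate of
Best–Trudgian's `limsup M(x)x^{-1/2} ≥ 1.6383` (`ν ≈ 1500`) the standard builder would not finish.

This file provides a drop-in builder `mkTablesFast` with the SAME output type and the same validity
predicate `Tables.Valid` (so `mem_zetaBox` applies verbatim), computing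

* the Bernoulli array by the same defining recursion but with the binomials of one row carried
  along incrementally, `C(n,k+1) = C(n,k)(n-k)/(k+1)` (`bernArrFast`, proved EQUAL to `bernArr`,
  hence the Euler–Maclaurin ratios are literally the same list: `emRatiosFast_eq`);
* the `log` table additively: `log 1 = 0`, `log n = log (n-1) - log (1 - 1/n)` when `n` is its own
  least prime factor (series ratio `1/n`), and `log n = log p + log (n/p)`, `p = minFac n`, otherwise
  (`mkLogsFast`, soundness `mkLogsFast_spec`).

## Main definitions and results (namespace `Literature.NumberTheory.LFunctions.ZetaNumerics`)

* `bernNextFast`, `bernArrFast`, `bernArrFast_eq : bernArrFast m = bernArr m`;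
* `emRatiosFast`, `emRatiosFast_eq : emRatiosFast ν = emRatios ν`;
* `mkLogsFast`, `mkLogsFast_spec`;
* `mkTablesFast`, **`mkTablesFast_valid`** (`mkTablesFast … = some T → T.Valid`), `mkTablesFast_S`.

## References

* H. M. Edwards, *Riemann's Zeta Function* (1974), §6.4 (Euler–Maclaurin for `ζ`). [Edwards1974]
* A. M. Odlyzko, H. J. J. te Riele, *Disproof of the Mertens conjecture*, J. reine angew. Math.
  357 (1985), §4.2. [OdlyzkoTeRiele1985]
-/

open Finset
open Literature.Analysis.ValidatedNumerics.NumericsMP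

namespace Literature.NumberTheory.LFunctions.ZetaNumerics

/-! ## Bernoulli numbers in quadratic time -/

/-- Inner loop of `bernNextFast`: with `n = A.size`, from index `k`, the binomial `c = C(n,k)` and
the partial sum `acc = Σ_{j<k} C(n,j)/(n-j+1) · A[j]`, run `fuel` more steps. [folklore] -/
def bernNextLoop (A : Array ℚ) (n : ℕ) : ℕ → ℕ → ℕ → ℚ → ℚ
  | 0, _, _, acc => acc
  | fuel + 1, k, c, acc =>
      bernNextLoop A n fuel (k + 1) (c * (n - k) / (k + 1))
        (acc + (c : ℚ) / (n - k + 1) * A.getD k 0)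

/-- `B'_n = 1 - Σ_{k<n} C(n,k)/(n-k+1) · B'_k` from `A = #[B'_0, …, B'_{n-1}]`, the binomials of
row `n` being carried along (`n` big-integer operations instead of `Θ(n²)`). [folklore] -/
def bernNextFast (A : Array ℚ) : ℚ :=
  let n := A.size
  1 - bernNextLoop A n n 0 1 0

/-- `#[B'_0, …, B'_{m-1}]` by the defining recursion, quadratic time. [folklore] -/
def bernArrFast : ℕ → Array ℚ
  | 0 => #[]
  | m + 1 => let A := bernArrFast m; A.push (bernNextFast A)

/-- Invariant of the inner loop. [folklore] -/
theorem bernNextLoop_spec (A : Array ℚ) (n : ℕ) :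
    ∀ (fuel k c : ℕ) (acc : ℚ), k + fuel ≤ n → c = n.choose k →
      acc = ∑ j ∈ range k, (n.choose j : ℚ) / (n - j + 1) * A.getD j 0 →
      bernNextLoop A n fuel k c acc =
        ∑ j ∈ range (k + fuel), (n.choose j : ℚ) / (n - j + 1) * A.getD j 0
  | 0, k, c, acc, _, _, hacc => by simpa [bernNextLoop] using hacc
  | fuel + 1, k, c, acc, hk, hc, hacc => by
    simp only [bernNextLoop]
    have hc' : c * (n - k) / (k + 1) = n.choose (k + 1) := by
      rw [hc, ← Nat.choose_succ_right_eq, Nat.mul_div_cancel _ (Nat.succ_pos k)]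
    have hacc' : acc + (c : ℚ) / (n - k + 1) * A.getD k 0 =
        ∑ j ∈ range (k + 1), (n.choose j : ℚ) / (n - j + 1) * A.getD j 0 := by
      rw [sum_range_succ, hacc, hc]
    rw [bernNextLoop_spec A n fuel (k + 1) _ _ (by omega) hc' hacc']
    have e : k + 1 + fuel = k + (fuel + 1) := by omega
    rw [e]

/-- The fast step is the standard step. [folklore] -/
theorem bernNextFast_eq (A : Array ℚ) : bernNextFast A = bernNext A := by
  unfold bernNextFast bernNext
  simp only
  rw [bernNextLoop_spec A A.size A.size 0 1 0 (by omega) (by simp) (by simp), zero_add]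

/-- `bernArrFast = bernArr`. [folklore] -/
theorem bernArrFast_eq : ∀ m, bernArrFast m = bernArr m
  | 0 => rfl
  | m + 1 => by
    simp only [bernArrFast, bernArr, bernArrFast_eq m, bernNextFast_eq]

/-- The Euler–Maclaurin coefficient list from the fast Bernoulli array. [folklore] -/
def emCoeffListFast (ν : ℕ) : List ℚ :=
  let A := bernArrFast (2 * ν + 4)
  (List.range (ν + 2)).map (coeffOfArr A)

/-- [folklore] -/
theorem emCoeffListFast_eq (ν : ℕ) : emCoeffListFast ν = emCoeffList ν := by
  unfold emCoeffListFast emCoeffList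
  simp only [bernArrFast_eq]

/-- The ratio list `r_k = c_{k+1}/c_k` (with the non-vanishing check), fast version. [folklore] -/
def emRatiosFast (ν : ℕ) : Option (List ℚ) :=
  let cs := emCoeffListFast ν
  if (List.range (ν - 1)).all (fun i ↦ decide (cs.getD (i + 1) 0 ≠ 0)) then
    some ((List.range (ν - 1)).map fun i ↦ cs.getD (i + 2) 0 / cs.getD (i + 1) 0)
  else none

/-- `emRatiosFast = emRatios`. [folklore] -/
theorem emRatiosFast_eq (ν : ℕ) : emRatiosFast ν = emRatios ν := by
  unfold emRatiosFast emRatios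
  simp only [emCoeffListFast_eq]

/-! ## The additive `log` table -/

/-- The `log` table `[junk, log 1, …, log n]` at scale `S'`, built additively: `log 1 = 0`;
`log m = log (m-1) - log (1 - 1/m)` when `minFac m = m` (one series with ratio `1/m`, `K` terms);
`log m = log p + log (m/p)`, `p = minFac m`, otherwise (`none` on failure). [folklore] -/
def mkLogsFast (S' K : ℕ) : ℕ → Option (Array MI)
  | 0 => some #[default]
  | n + 1 =>
    match mkLogsFast S' K n with
    | none => none
    | some A =>
      if n = 0 then some (A.push (MI.ofInt S' 0))
      else if (n + 1).minFac = n + 1 then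
        match MI.logOneSub S' K (MI.ofFrac S' 1 (n + 1)) with
        | some Y => some (A.push ((A.getD n default).sub Y))
        | none => none
      else
        some (A.push ((A.getD (n + 1).minFac default).add (A.getD ((n + 1) / (n + 1).minFac) default)))

/-- Reading an old entry after a `push`. [folklore] -/
private lemma getD_push_of_lt {A : Array MI} {x : MI} {m : ℕ} (hm : m < A.size) :
    (A.push x).getD m default = A.getD m default := by
  rw [Array.getD_eq_getD_getElem?, Array.getElem?_push_lt hm, Option.getD_some,
    Array.getD_eq_getD_getElem?, getElem?_pos A m hm, Option.getD_some]

/-- Reading the new entry after a `push`. [folklore] -/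
private lemma getD_push_size {A : Array MI} {x : MI} :
    (A.push x).getD A.size default = x := by
  rw [Array.getD_eq_getD_getElem?, Array.getElem?_push_size, Option.getD_some]

/-- Soundness of `mkLogsFast`: size `n + 1` and `log m ∈ logs[m]` for `1 ≤ m ≤ n`. [folklore] -/
theorem mkLogsFast_spec {S' K : ℕ} (hS' : 0 < S') :
    ∀ (n : ℕ) {A : Array MI}, mkLogsFast S' K n = some A →
      A.size = n + 1 ∧ ∀ m : ℕ, 1 ≤ m → m ≤ n → MI.mem S' (Real.log m) (A.getD m default)
  | 0, A, h => by
    simp only [mkLogsFast, Option.some.injEq] at h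
    subst h
    exact ⟨rfl, fun m h1 h2 ↦ by omega⟩
  | n + 1, A, h => by
    simp only [mkLogsFast] at h
    split at h
    · simp at h
    · rename_i A0 hA0
      obtain ⟨hsz, hmem⟩ := mkLogsFast_spec hS' n hA0
      -- the old entries survive any `push`
      have hold : ∀ (x : MI) (m : ℕ), 1 ≤ m → m ≤ n →
          MI.mem S' (Real.log m) ((A0.push x).getD m default) := fun x m h1 h2 ↦ by
        rw [getD_push_of_lt (by rw [hsz]; omega)]
        exact hmem m h1 h2
      -- it suffices to treat the new entry
      have key : ∀ x : MI, MI.mem S' (Real.log (n + 1 : ℕ)) x → A = A0.push x →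
          A.size = n + 1 + 1 ∧
            ∀ m : ℕ, 1 ≤ m → m ≤ n + 1 → MI.mem S' (Real.log m) (A.getD m default) := by
        rintro x hx rfl
        refine ⟨by simp [hsz], fun m h1 h2 ↦ ?_⟩
        rcases Nat.lt_succ_iff_lt_or_eq.1 (Nat.lt_succ_of_le h2) with hlt | heq
        · exact hold x m h1 (Nat.lt_succ_iff.1 hlt)
        · subst heq
          have e2 : (A0.push x).getD (n + 1) default = x := by
            rw [← hsz]; exact getD_push_size
          rw [e2]
          exact hx
      split_ifs at h with h0 hp
      · -- `n = 0`: `log 1 = 0`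
        subst h0
        simp only [Option.some.injEq] at h
        refine key _ ?_ h.symm
        simpa using MI.mem_ofInt S' 0
      · -- `minFac (n+1) = n+1`: `log (n+1) = log n - log (1 - 1/(n+1))`
        split at h
        · rename_i Y hY
          simp only [Option.some.injEq] at h
          refine key _ ?_ h.symm
          have hn1 : 1 ≤ n := Nat.one_le_iff_ne_zero.2 h0
          have hlog := hmem n hn1 le_rfl
          have hY' := MI.mem_logOneSub hS' hY (MI.mem_ofFrac S' 1 (q := n + 1) (Nat.succ_pos n))
          have hnr : (0 : ℝ) < n := by exact_mod_cast hn1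
          have e : Real.log (1 - ((1 : ℤ) : ℝ) / (n + 1 : ℕ)) = Real.log n - Real.log (n + 1 : ℕ) := by
            rw [← Real.log_div hnr.ne' (by positivity)]
            congr 1
            push_cast
            field_simp
            ring
          rw [e] at hY'
          have := MI.mem_sub hlog hY'
          convert this using 1
          ring
        · simp at h
      · -- composite: `log (n+1) = log p + log ((n+1)/p)`, `p = minFac (n+1)`
        simp only [Option.some.injEq] at h
        refine key _ ?_ h.symm
        set m := n + 1 with hm
        have hm1 : m ≠ 1 := by omega
        have hpr : m.minFac.Prime := Nat.minFac_prime hm1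
        have h2p : 2 ≤ m.minFac := hpr.two_le
        have hle : m.minFac ≤ m := Nat.minFac_le (by omega)
        have hltm : m.minFac < m := lt_of_le_of_ne hle hp
        obtain ⟨q, hq⟩ := Nat.minFac_dvd m
        have hq1 : 1 ≤ q := by
          rcases Nat.eq_zero_or_pos q with h' | h'
          · rw [h', mul_zero] at hq; omega
          · exact h'
        have hqdiv : m / m.minFac = q := Nat.div_eq_of_eq_mul_right (by omega) hq
        have hqn : q ≤ n := by
          have : 2 * q ≤ m := by
            calc 2 * q ≤ m.minFac * q := Nat.mul_le_mul_right _ h2p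
              _ = m := hq.symm
          omega
        have hpn : m.minFac ≤ n := by omega
        have h1 := hmem m.minFac (by omega) hpn
        have h2 := hmem q hq1 hqn
        have hmr : ((m : ℕ) : ℝ) = (m.minFac : ℝ) * (q : ℝ) := by exact_mod_cast hq
        have e : Real.log (m : ℕ) = Real.log (m.minFac : ℕ) + Real.log (q : ℕ) := by
          rw [hmr, Real.log_mul (by exact_mod_cast hpr.pos.ne') (by exact_mod_cast (show q ≠ 0 by omega))]
        rw [hqdiv, e]
        exact MI.mem_add h1 h2

/-! ## The fast table builder -/

/-- Build tables as `mkTables` does (`π` and the logarithms at scale `S · 2^guard`, rounded to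
`S`), with the quadratic Bernoulli array and the additive `log` table. [folklore] -/
def mkTablesFast (S N nu guard Klog Kpi Kexp kexp KI kI : ℕ) : Option Tables :=
  let S' := S * 2 ^ guard
  if 0 < S ∧ 2 ≤ N ∧ nu ≠ 0 then
    match MI.pi S' Kpi, mkLogsFast S' Klog N, emRatiosFast nu with
    | some P, some A, some R =>
        some ⟨S, N, nu, MI.rescale S' S P, A.map (MI.rescale S' S), R, Kexp, kexp, KI, kI⟩
    | _, _, _ => none
  else none

/-- Tables built by `mkTablesFast` are valid (so `mem_zetaBox` applies). [folklore] -/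
theorem mkTablesFast_valid {S N nu guard Klog Kpi Kexp kexp KI kI : ℕ} {T : Tables}
    (h : mkTablesFast S N nu guard Klog Kpi Kexp kexp KI kI = some T) : T.Valid := by
  unfold mkTablesFast at h
  simp only at h
  split_ifs at h with hc
  split at h
  · rename_i P A R hP hA hR
    simp only [Option.some.injEq] at h
    subst h
    obtain ⟨hS, hN, hnu⟩ := hc
    have hS' : 0 < S * 2 ^ guard := Nat.mul_pos hS (pow_pos (by norm_num) _)
    obtain ⟨hsz, hmem⟩ := mkLogsFast_spec (K := Klog) hS' N hA
    refine ⟨hS, hN, hnu, MI.mem_rescale hS' S (MI.mem_pi _ hP), by simp [hsz], fun n h1 h2 ↦ ?_, ?_⟩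
    · have h2' : n ≤ N := h2
      have hlt : n < A.size := by rw [hsz]; omega
      show MI.mem S (Real.log n) ((A.map (MI.rescale (S * 2 ^ guard) S)).getD n default)
      have e : (A.map (MI.rescale (S * 2 ^ guard) S)).getD n default =
          MI.rescale (S * 2 ^ guard) S (A.getD n default) := by
        rw [Array.getD_eq_getD_getElem?, Array.getElem?_map, getElem?_pos A n hlt, Option.map_some,
          Option.getD_some, Array.getD_eq_getD_getElem?, getElem?_pos A n hlt, Option.getD_some]
      rw [e]
      exact MI.mem_rescale hS' S (hmem n h1 h2)
    · rw [← emRatiosFast_eq]; exact hR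
  · simp at h

/-- `mkTablesFast` records the scale it is given. [folklore] -/
theorem mkTablesFast_S {S N nu guard Klog Kpi Kexp kexp KI kI : ℕ} {T : Tables}
    (h : mkTablesFast S N nu guard Klog Kpi Kexp kexp KI kI = some T) : T.S = S := by
  unfold mkTablesFast at h
  simp only at h
  split_ifs at h
  split at h
  · simp only [Option.some.injEq] at h
    subst h; rfl
  · simp at h

/-- `mkTablesFast` records the truncation point it is given. [folklore] -/
theorem mkTablesFast_N {S N nu guard Klog Kpi Kexp kexp KI kI : ℕ} {T : Tables}
    (h : mkTablesFast S N nu guard Klog Kpi Kexp kexp KI kI = some T) : T.N = N := by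
  unfold mkTablesFast at h
  simp only at h
  split_ifs at h
  split at h
  · simp only [Option.some.injEq] at h
    subst h; rfl
  · simp at h

end Literature.NumberTheory.LFunctions.ZetaNumerics
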